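import Summits.QuantumFields.YangMills.Theses.ConvexGribovBody
import Literature.MathematicalPhysics.QuantumFieldTheory.LatticeGaugeProofs
import Literature.MathematicalPhysics.QuantumLattice.GaugeGroupsProofs

/-!
# `CovarianceBound` — negative lemma (setup): the adversarial gauge and the configuration-wise bound

Support file I (of two) for crux `stmt-QuantumFields-8780` (`ConvexGribovBody.CovarianceBound`), extracted
from the standing disprover's work file `Cruxes/CovarianceBound/Disproof.lean` (§A): the deterministic half of
"`CovarianceBound` is false without minimality". File II (`FalseWithoutMinimality.lean`) adds the measure side
and the refutation of the weakened statement. Tree objects only; nothing is posited; axioms `propext`,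
`Classical.choice`, `Quot.sound`.

The crux integrates, against Wilson's measure on `(2S+1)⁴`, the supremum over the ABSOLUTE MINIMISERS `h` of
the slice Coulomb functional of the equal-time covariance integrand
`cov(U,h,p) = (2S+1)⁻³ Σ_j ‖Σ_y e^{-2πi p·y/(2S+1)} ½(ρ(U^h_{(0,y),j}) − ρ(U^h_{(0,y),j})ᴴ)‖²_F` (`fro`, `cov`
below are these `let`s verbatim) and asks for a volume-uniform bound at every spatial momentum, `p = 0`
included. Here, for `G = SU(2)` in the fundamental representation (`su2Fund`, certified simple by the tree's
`isSimpleCompactGroup_specialUnitaryGroup_holds`):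

* `twist = diag(i, −i)`, `lineGauge` / `hOf U`: the twisted axial transport along direction `1` of the
  time-zero slice (`Q 0 = 1`, `Q (n+1) = σ · Q n · U((x with x₁ := n), 1)`, `h_U(x) = Q (x 1).val`).
* `gaugeTransform_hOf`: for EVERY configuration `U`, every direction-`1` link that does not wrap around the
  torus is gauged to `σ⁻¹ = diag(−i, i)`.
* `card_bad_le`, `sum_im_le`: the `≤ L²` wrapping links are bounded by unitarity, so the imaginary parts of the
  `(0,0)` entries of the gauged direction-`1` links sum to `≤ −(L³ − 2L²)` (`L = 2S+1`).
* `le_cov_hOf`: hence `cov(U, h_U, 0) ≥ L(L−2)² ≥ 2S+1` for every `U` (`S ≥ 1`); `cov_zero_le`: the crude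
  bound `cov(U, h, 0) ≤ 12 L⁶` for every `h` (for `BddAbove` / integrability in file II).
-/

set_option autoImplicit false

namespace Summit.QuantumFields.YangMills.Theorems.CovarianceBound.Negative

open scoped Matrix ComplexConjugate
open MeasureTheory
open Literature.MathematicalPhysics.QuantumFieldTheory Literature.MathematicalPhysics.QuantumLattice

noncomputable section

/-- `SU(2)` as a matrix group. -/
abbrev SU2 : Type := Matrix.specialUnitaryGroup (Fin 2) ℂ

/-- The twist `σ = diag(i, -i) ∈ SU(2)`. -/
def twist : SU2 :=
  ⟨!![Complex.I, 0; 0, -Complex.I], by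
    rw [Matrix.mem_specialUnitaryGroup_iff, Matrix.mem_unitaryGroup_iff]
    refine ⟨?_, ?_⟩
    · ext i j
      fin_cases i <;> fin_cases j <;>
        simp [Matrix.mul_apply, Fin.sum_univ_two, Matrix.star_apply]
    · simp [Matrix.det_fin_two]⟩

/-- The matrix of the twist. -/
@[simp] theorem twist_val : (twist : Matrix (Fin 2) (Fin 2) ℂ) = !![Complex.I, 0; 0, -Complex.I] := rfl

/-- The `(0,0)` entry of `σ⁻¹` is `−i`. -/
theorem twist_inv_val_zero_zero : ((twist⁻¹ : SU2) : Matrix (Fin 2) (Fin 2) ℂ) 0 0 = -Complex.I := by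
  rw [← Matrix.star_eq_inv, Matrix.specialUnitaryGroup.coe_star, twist_val]
  simp [Matrix.star_apply]

variable {S : ℕ}

/-- Twisted parallel transport along direction `1` of the time-zero slice: `Q 0 = 1`,
`Q (n+1) = σ · Q n · U((x with x₁ := n), 1)`. -/
def lineGauge (U : GaugeConfig 4 (2 * S + 1) SU2) (x : Site 4 (2 * S + 1)) : ℕ → SU2
  | 0 => 1
  | n + 1 => twist * lineGauge U x n * U (Function.update x 1 (n : ZMod (2 * S + 1)), 1)

/-- The adversarial gauge transformation `h_U(x) = Q_{x}((x 1).val)`. -/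
def hOf (U : GaugeConfig 4 (2 * S + 1) SU2) (x : Site 4 (2 * S + 1)) : SU2 :=
  lineGauge U x (x 1).val

/-- The twisted transport does not depend on the direction-`1` coordinate of its base point. -/
theorem lineGauge_update (U : GaugeConfig 4 (2 * S + 1) SU2) (x : Site 4 (2 * S + 1))
    (c : ZMod (2 * S + 1)) (n : ℕ) :
    lineGauge U (Function.update x 1 c) n = lineGauge U x n := by
  induction n with
  | zero => rfl
  | succ n ih => simp only [lineGauge, ih, Function.update_idem]

/-- Shifting a site in direction `1` updates its coordinate `1`. -/
theorem shift_one_eq_update (x : Site 4 (2 * S + 1)) :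
    x.shift 1 = Function.update x 1 (x 1 + 1) := by
  funext k
  by_cases hk : k = 1
  · subst hk; simp [Site.shift]
  · simp [Site.shift, hk]

/-- On every link `(x, 1)` that does not wrap around the torus, the twisted transport gauges the
link variable to `σ⁻¹`. -/
theorem gaugeTransform_hOf (U : GaugeConfig 4 (2 * S + 1) SU2) (x : Site 4 (2 * S + 1))
    (hx : (x 1).val + 1 < 2 * S + 1) :
    gaugeTransform (hOf U) U (x, 1) = twist⁻¹ := by
  have hval : (x 1 + 1).val = (x 1).val + 1 := by
    rw [ZMod.val_add, ZMod.val_one_eq_one_mod, Nat.add_mod_mod, Nat.mod_eq_of_lt hx]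
  simp only [gaugeTransform, hOf]
  rw [shift_one_eq_update, Function.update_self, hval]
  simp only [lineGauge]
  rw [Function.update_idem, ZMod.natCast_zmod_val, Function.update_eq_self, lineGauge_update]
  group


/-! ### The crux's integrand, verbatim, as named functions -/

/-- The crux's squared Frobenius norm `Σ_{a,b} ‖M a b‖²` (its `let fro`). -/
def fro {N : ℕ} (M : Matrix (Fin N) (Fin N) ℂ) : ℝ := ∑ a, ∑ b, ‖M a b‖ ^ 2

/-- The crux's equal-time covariance integrand `cov(U,h,p)` (its `let cov`, verbatim). -/
def cov {G : Type} [Group G] [TopologicalSpace G] (r : LatticeRep G) (S : ℕ)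
    (U : GaugeConfig 4 (2 * S + 1) G) (h : Site 4 (2 * S + 1) → G)
    (p : Fin 3 → ZMod (2 * S + 1)) : ℝ :=
  (∑ j : Fin 3, fro (∑ y : Fin 3 → ZMod (2 * S + 1),
    Complex.exp (-(2 * Real.pi * Complex.I * (∑ i : Fin 3, ((p i).val : ℂ) * ((y i).val : ℂ)) /
      (2 * S + 1 : ℂ))) •
      ((1 / 2 : ℂ) • (r.ρ (gaugeTransform h U (Fin.cons (0 : ZMod (2 * S + 1)) y, j.succ)) -
        (r.ρ (gaugeTransform h U (Fin.cons (0 : ZMod (2 * S + 1)) y, j.succ)))ᴴ)))) /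
    ((2 * S + 1 : ℝ) ^ 3)

/-- The fundamental lattice representation of `SU(2)`. -/
def su2Fund : LatticeRep SU2 :=
  ⟨2, fundamentalRep (Fin 2), continuous_fundamentalRep _, fundamentalRep_injective _,
    fundamentalRep_mem_unitaryGroup⟩

/-- `SU(2)` is a compact simple Lie group, unconditionally (tree:
`isSimpleCompactGroup_specialUnitaryGroup_holds`). -/
theorem isCompactSimpleLieGroup_SU2 : IsCompactSimpleLieGroup SU2 :=
  isCompactSimpleLieGroup_specialUnitaryGroup isSimpleCompactGroup_specialUnitaryGroup_holds le_rfl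

/-- At zero momentum every Fourier phase of the crux's integrand is `1`. -/
theorem phase_zero (y : Fin 3 → ZMod (2 * S + 1)) :
    Complex.exp (-(2 * Real.pi * Complex.I *
      (∑ i : Fin 3, (((0 : Fin 3 → ZMod (2 * S + 1)) i).val : ℂ) * ((y i).val : ℂ)) /
        (2 * S + 1 : ℂ))) = 1 := by
  simp

/-- Entries of `½(A - Aᴴ)` have norm at most `1` for unitary `A`. -/
theorem norm_half_sub_conjTranspose_apply_le {N : ℕ} {A : Matrix (Fin N) (Fin N) ℂ}
    (hA : A ∈ Matrix.unitaryGroup (Fin N) ℂ) (a b : Fin N) :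
    ‖((1 / 2 : ℂ) • (A - Aᴴ)) a b‖ ≤ 1 := by
  have h1 := entry_norm_bound_of_unitary hA a b
  have h2 := entry_norm_bound_of_unitary hA b a
  rw [Matrix.smul_apply, Matrix.sub_apply, Matrix.conjTranspose_apply, smul_eq_mul, norm_mul]
  have h3 : ‖A a b - star (A b a)‖ ≤ 2 := by
    refine (norm_sub_le _ _).trans ?_
    rw [norm_star]; linarith
  have : ‖(1 / 2 : ℂ)‖ = 1 / 2 := by simp
  rw [this]; linarith

/-- The `(0,0)` entry of `½(A - Aᴴ)` is `i · Im (A 0 0)`. -/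
theorem half_sub_conjTranspose_apply_zero {N : ℕ} (A : Matrix (Fin (N + 1)) (Fin (N + 1)) ℂ) :
    ((1 / 2 : ℂ) • (A - Aᴴ)) 0 0 = Complex.I * ((A 0 0).im : ℂ) := by
  rw [Matrix.smul_apply, Matrix.sub_apply, Matrix.conjTranspose_apply, smul_eq_mul]
  apply Complex.ext <;> simp; ring

/-- Crude upper bound for the zero-momentum integrand over ALL gauge transformations:
`cov(U,h,0) ≤ 12 · (2S+1)⁶` (used only for `BddAbove` / integrability). -/
theorem cov_zero_le (U : GaugeConfig 4 (2 * S + 1) SU2) (h : Site 4 (2 * S + 1) → SU2) :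
    cov su2Fund S U h 0 ≤ 12 * ((2 * S + 1 : ℝ) ^ 3) ^ 2 := by
  unfold cov
  have hL : (1 : ℝ) ≤ (2 * S + 1 : ℝ) ^ 3 := one_le_pow₀ (by norm_cast; omega)
  have hcard : (Fintype.card (Fin 3 → ZMod (2 * S + 1)) : ℝ) = (2 * S + 1 : ℝ) ^ 3 := by
    rw [Fintype.card_fun, ZMod.card, Fintype.card_fin]; push_cast; ring
  -- each Frobenius term is at most 4 · L⁶
  have hterm : ∀ j : Fin 3, fro (∑ y : Fin 3 → ZMod (2 * S + 1),
      Complex.exp (-(2 * Real.pi * Complex.I *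
        (∑ i : Fin 3, (((0 : Fin 3 → ZMod (2 * S + 1)) i).val : ℂ) * ((y i).val : ℂ)) /
          (2 * S + 1 : ℂ))) •
        ((1 / 2 : ℂ) • (su2Fund.ρ (gaugeTransform h U (Fin.cons (0 : ZMod (2 * S + 1)) y, j.succ)) -
          (su2Fund.ρ (gaugeTransform h U (Fin.cons (0 : ZMod (2 * S + 1)) y, j.succ)))ᴴ))) ≤
      4 * ((2 * S + 1 : ℝ) ^ 3) ^ 2 := by
    intro j
    simp only [phase_zero, one_smul]
    unfold fro
    have hentry : ∀ a b : Fin 2, ‖(∑ y : Fin 3 → ZMod (2 * S + 1),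
        ((1 / 2 : ℂ) • (su2Fund.ρ (gaugeTransform h U (Fin.cons (0 : ZMod (2 * S + 1)) y, j.succ)) -
          (su2Fund.ρ (gaugeTransform h U (Fin.cons (0 : ZMod (2 * S + 1)) y, j.succ)))ᴴ))) a b‖ ≤
        (2 * S + 1 : ℝ) ^ 3 := by
      intro a b
      rw [Matrix.sum_apply]
      refine (norm_sum_le _ _).trans ?_
      calc ∑ y : Fin 3 → ZMod (2 * S + 1), ‖((1 / 2 : ℂ) •
              (su2Fund.ρ (gaugeTransform h U (Fin.cons (0 : ZMod (2 * S + 1)) y, j.succ)) -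
                (su2Fund.ρ (gaugeTransform h U (Fin.cons (0 : ZMod (2 * S + 1)) y, j.succ)))ᴴ)) a b‖
          ≤ ∑ _y : Fin 3 → ZMod (2 * S + 1), (1 : ℝ) :=
            Finset.sum_le_sum fun y _ =>
              norm_half_sub_conjTranspose_apply_le (su2Fund.mem_unitary _) a b
        _ = (2 * S + 1 : ℝ) ^ 3 := by
            rw [Finset.sum_const, Finset.card_univ, nsmul_eq_mul, mul_one, hcard]
    have hsq : ∀ a b : Fin 2, ‖(∑ y : Fin 3 → ZMod (2 * S + 1),
        ((1 / 2 : ℂ) • (su2Fund.ρ (gaugeTransform h U (Fin.cons (0 : ZMod (2 * S + 1)) y, j.succ)) -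
          (su2Fund.ρ (gaugeTransform h U (Fin.cons (0 : ZMod (2 * S + 1)) y, j.succ)))ᴴ))) a b‖ ^ 2 ≤
        ((2 * S + 1 : ℝ) ^ 3) ^ 2 := fun a b =>
      pow_le_pow_left₀ (norm_nonneg _) (hentry a b) 2
    calc _ ≤ ∑ _a : Fin 2, ∑ _b : Fin 2, ((2 * S + 1 : ℝ) ^ 3) ^ 2 :=
          Finset.sum_le_sum fun a _ => Finset.sum_le_sum fun b _ => hsq a b
      _ = 4 * ((2 * S + 1 : ℝ) ^ 3) ^ 2 := by simp; ring
  have hsum : (∑ j : Fin 3, fro (∑ y : Fin 3 → ZMod (2 * S + 1),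
      Complex.exp (-(2 * Real.pi * Complex.I *
        (∑ i : Fin 3, (((0 : Fin 3 → ZMod (2 * S + 1)) i).val : ℂ) * ((y i).val : ℂ)) /
          (2 * S + 1 : ℂ))) •
        ((1 / 2 : ℂ) • (su2Fund.ρ (gaugeTransform h U (Fin.cons (0 : ZMod (2 * S + 1)) y, j.succ)) -
          (su2Fund.ρ (gaugeTransform h U (Fin.cons (0 : ZMod (2 * S + 1)) y, j.succ)))ᴴ)))) ≤
      12 * ((2 * S + 1 : ℝ) ^ 3) ^ 2 := by
    calc _ ≤ ∑ _j : Fin 3, 4 * ((2 * S + 1 : ℝ) ^ 3) ^ 2 := Finset.sum_le_sum fun j _ => hterm j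
      _ = 12 * ((2 * S + 1 : ℝ) ^ 3) ^ 2 := by simp; ring
  have hnn : (0 : ℝ) ≤ 12 * ((2 * S + 1 : ℝ) ^ 3) ^ 2 := by positivity
  calc _ ≤ 12 * ((2 * S + 1 : ℝ) ^ 3) ^ 2 / (2 * S + 1 : ℝ) ^ 3 :=
        div_le_div_of_nonneg_right hsum (by positivity)
    _ ≤ 12 * ((2 * S + 1 : ℝ) ^ 3) ^ 2 := div_le_self hnn hL


/-- The fundamental representation is the underlying matrix. -/
@[simp] theorem su2Fund_ρ (g : SU2) : su2Fund.ρ g = (g : Matrix (Fin 2) (Fin 2) ℂ) := rfl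

/-- `Fin.cons 0 y` has first spatial coordinate `y 0`. -/
theorem cons_apply_one (y : Fin 3 → ZMod (2 * S + 1)) :
    (Fin.cons (0 : ZMod (2 * S + 1)) y : Site 4 (2 * S + 1)) 1 = y 0 := rfl

/-- The number of wrap-around sites (`y 0 = L - 1`) is at most `L²`. -/
theorem card_bad_le :
    ((Finset.univ.filter fun y : Fin 3 → ZMod (2 * S + 1) => ¬ ((y 0).val + 1 < 2 * S + 1)).card
      ≤ (2 * S + 1) ^ 2) := by
  have hcard : Fintype.card (Fin 2 → ZMod (2 * S + 1)) = (2 * S + 1) ^ 2 := by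
    rw [Fintype.card_fun, ZMod.card, Fintype.card_fin]
  rw [← hcard, ← Finset.card_univ]
  refine Finset.card_le_card_of_injOn (fun y => Fin.tail y) (fun _ _ => by simp) ?_
  intro y hy y' hy' h
  simp only [Finset.coe_filter, Finset.mem_univ, true_and, Set.mem_setOf_eq, not_lt] at hy hy'
  have h0 : y 0 = y' 0 := by
    apply ZMod.val_injective
    have := ZMod.val_lt (y 0); have := ZMod.val_lt (y' 0); omega
  rw [← Fin.cons_self_tail y, ← Fin.cons_self_tail y', h0]
  exact congrArg _ h

/-- The imaginary parts of the `(0,0)` entries of the adversarially gauged direction-`1` links sum to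
at most `-(L³ - 2L²)`: `-1` on every non-wrapping link, at most `1` on the `≤ L²` wrapping ones. -/
theorem sum_im_le (U : GaugeConfig 4 (2 * S + 1) SU2) :
    ∑ y : Fin 3 → ZMod (2 * S + 1),
      (((gaugeTransform (hOf U) U (Fin.cons (0 : ZMod (2 * S + 1)) y, (0 : Fin 3).succ) : SU2) :
        Matrix (Fin 2) (Fin 2) ℂ) 0 0).im
      ≤ -((2 * S + 1 : ℝ) ^ 3) + 2 * (2 * S + 1 : ℝ) ^ 2 := by
  have hgood : ∀ y : Fin 3 → ZMod (2 * S + 1), (y 0).val + 1 < 2 * S + 1 →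
      (((gaugeTransform (hOf U) U (Fin.cons (0 : ZMod (2 * S + 1)) y, (0 : Fin 3).succ) : SU2) :
        Matrix (Fin 2) (Fin 2) ℂ) 0 0).im = -1 := by
    intro y hy
    have h := gaugeTransform_hOf U (Fin.cons (0 : ZMod (2 * S + 1)) y) hy
    rw [show ((Fin.cons (0 : ZMod (2 * S + 1)) y, (0 : Fin 3).succ) : Edge 4 (2 * S + 1)) =
      (Fin.cons (0 : ZMod (2 * S + 1)) y, 1) from rfl, h, twist_inv_val_zero_zero]
    simp
  have hbad : ∀ y : Fin 3 → ZMod (2 * S + 1),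
      (((gaugeTransform (hOf U) U (Fin.cons (0 : ZMod (2 * S + 1)) y, (0 : Fin 3).succ) : SU2) :
        Matrix (Fin 2) (Fin 2) ℂ) 0 0).im ≤ 1 := fun y =>
    (Complex.im_le_norm _).trans
      (entry_norm_bound_of_unitary (gaugeTransform (hOf U) U _).prop.1 0 0)
  have hcardR : (Fintype.card (Fin 3 → ZMod (2 * S + 1)) : ℝ) = (2 * S + 1 : ℝ) ^ 3 := by
    rw [Fintype.card_fun, ZMod.card, Fintype.card_fin]; push_cast; ring
  have hbadR : (((Finset.univ.filter fun y : Fin 3 → ZMod (2 * S + 1) =>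
      ¬ ((y 0).val + 1 < 2 * S + 1)).card : ℕ) : ℝ) ≤ (2 * S + 1 : ℝ) ^ 2 := by
    exact_mod_cast card_bad_le (S := S)
  calc ∑ y : Fin 3 → ZMod (2 * S + 1),
        (((gaugeTransform (hOf U) U (Fin.cons (0 : ZMod (2 * S + 1)) y, (0 : Fin 3).succ) : SU2) :
          Matrix (Fin 2) (Fin 2) ℂ) 0 0).im
      ≤ ∑ y : Fin 3 → ZMod (2 * S + 1),
          ((-1 : ℝ) + 2 * (if ¬ ((y 0).val + 1 < 2 * S + 1) then (1 : ℝ) else 0)) := by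
        refine Finset.sum_le_sum fun y _ => ?_
        by_cases hy : (y 0).val + 1 < 2 * S + 1
        · rw [hgood y hy]; simp [hy]
        · simp only [hy, not_false_eq_true, ↓reduceIte]; linarith [hbad y]
    _ = -((2 * S + 1 : ℝ) ^ 3) + 2 * (((Finset.univ.filter fun y : Fin 3 → ZMod (2 * S + 1) =>
          ¬ ((y 0).val + 1 < 2 * S + 1)).card : ℕ) : ℝ) := by
        rw [Finset.sum_add_distrib, Finset.sum_const, Finset.card_univ, nsmul_eq_mul, hcardR,
          ← Finset.mul_sum, Finset.sum_boole]
        simp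
    _ ≤ -((2 * S + 1 : ℝ) ^ 3) + 2 * (2 * S + 1 : ℝ) ^ 2 := by linarith

/-- **Configuration-wise lower bound.** For EVERY configuration `U`, the zero-momentum integrand at
the adversarial gauge transformation `h_U` is at least `2S + 1` (in fact `≥ L (L-2)²`, `L = 2S+1 ≥ 3`). -/
theorem le_cov_hOf (hS : 1 ≤ S) (U : GaugeConfig 4 (2 * S + 1) SU2) :
    (2 * S + 1 : ℝ) ≤ cov su2Fund S U (hOf U) 0 := by
  unfold cov
  simp only [phase_zero, one_smul, su2Fund_ρ]
  have hL3 : (3 : ℝ) ≤ (2 * S + 1 : ℝ) := by norm_cast; omega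
  -- the j = 0 term, entry (0,0)
  set M : Matrix (Fin 2) (Fin 2) ℂ := ∑ y : Fin 3 → ZMod (2 * S + 1),
    (1 / 2 : ℂ) • (((gaugeTransform (hOf U) U (Fin.cons (0 : ZMod (2 * S + 1)) y, (0 : Fin 3).succ) :
      SU2) : Matrix (Fin 2) (Fin 2) ℂ) -
      (((gaugeTransform (hOf U) U (Fin.cons (0 : ZMod (2 * S + 1)) y, (0 : Fin 3).succ) : SU2) :
        Matrix (Fin 2) (Fin 2) ℂ))ᴴ) with hM
  have hfro_nonneg : ∀ j : Fin 3, 0 ≤ fro (∑ y : Fin 3 → ZMod (2 * S + 1),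
      (1 / 2 : ℂ) • (((gaugeTransform (hOf U) U (Fin.cons (0 : ZMod (2 * S + 1)) y, j.succ) : SU2) :
        Matrix (Fin 2) (Fin 2) ℂ) -
        (((gaugeTransform (hOf U) U (Fin.cons (0 : ZMod (2 * S + 1)) y, j.succ) : SU2) :
          Matrix (Fin 2) (Fin 2) ℂ))ᴴ)) := fun j => by
    unfold fro; positivity
  have hsum : fro M ≤ ∑ j : Fin 3, fro (∑ y : Fin 3 → ZMod (2 * S + 1),
      (1 / 2 : ℂ) • (((gaugeTransform (hOf U) U (Fin.cons (0 : ZMod (2 * S + 1)) y, j.succ) : SU2) :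
        Matrix (Fin 2) (Fin 2) ℂ) -
        (((gaugeTransform (hOf U) U (Fin.cons (0 : ZMod (2 * S + 1)) y, j.succ) : SU2) :
          Matrix (Fin 2) (Fin 2) ℂ))ᴴ)) :=
    Finset.single_le_sum (f := fun j : Fin 3 => fro (∑ y : Fin 3 → ZMod (2 * S + 1),
      (1 / 2 : ℂ) • (((gaugeTransform (hOf U) U (Fin.cons (0 : ZMod (2 * S + 1)) y, j.succ) : SU2) :
        Matrix (Fin 2) (Fin 2) ℂ) -
        (((gaugeTransform (hOf U) U (Fin.cons (0 : ZMod (2 * S + 1)) y, j.succ) : SU2) :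
          Matrix (Fin 2) (Fin 2) ℂ))ᴴ))) (fun j _ => hfro_nonneg j) (Finset.mem_univ 0)
  have hentry : ‖M 0 0‖ ^ 2 ≤ fro M := by
    unfold fro
    calc ‖M 0 0‖ ^ 2 ≤ ∑ b : Fin 2, ‖M 0 b‖ ^ 2 :=
          Finset.single_le_sum (f := fun b : Fin 2 => ‖M 0 b‖ ^ 2) (fun b _ => by positivity)
            (Finset.mem_univ 0)
      _ ≤ ∑ a : Fin 2, ∑ b : Fin 2, ‖M a b‖ ^ 2 :=
          Finset.single_le_sum (f := fun a : Fin 2 => ∑ b : Fin 2, ‖M a b‖ ^ 2)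
            (fun a _ => by positivity) (Finset.mem_univ 0)
  have hM00 : M 0 0 = Complex.I * ((∑ y : Fin 3 → ZMod (2 * S + 1),
      (((gaugeTransform (hOf U) U (Fin.cons (0 : ZMod (2 * S + 1)) y, (0 : Fin 3).succ) : SU2) :
        Matrix (Fin 2) (Fin 2) ℂ) 0 0).im : ℝ) : ℂ) := by
    rw [hM, Matrix.sum_apply]
    simp_rw [half_sub_conjTranspose_apply_zero]
    rw [← Finset.mul_sum, Complex.ofReal_sum]
  have hnorm : ‖M 0 0‖ = |∑ y : Fin 3 → ZMod (2 * S + 1),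
      (((gaugeTransform (hOf U) U (Fin.cons (0 : ZMod (2 * S + 1)) y, (0 : Fin 3).succ) : SU2) :
        Matrix (Fin 2) (Fin 2) ℂ) 0 0).im| := by
    rw [hM00, norm_mul, Complex.norm_I, one_mul, Complex.norm_real, Real.norm_eq_abs]
  have him := sum_im_le U
  have habs : (2 * S + 1 : ℝ) ^ 3 - 2 * (2 * S + 1 : ℝ) ^ 2 ≤ ‖M 0 0‖ := by
    rw [hnorm]
    refine le_trans ?_ (neg_le_abs _)
    linarith
  have hpos : (0 : ℝ) ≤ (2 * S + 1 : ℝ) ^ 3 - 2 * (2 * S + 1 : ℝ) ^ 2 := by nlinarith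
  have hsq : ((2 * S + 1 : ℝ) ^ 3 - 2 * (2 * S + 1 : ℝ) ^ 2) ^ 2 ≤ fro M :=
    (pow_le_pow_left₀ hpos habs 2).trans hentry
  have key : ∀ L : ℝ, 3 ≤ L → L * L ^ 3 ≤ (L ^ 3 - 2 * L ^ 2) ^ 2 := by
    intro L hL
    have h1 : 1 ≤ (L - 2) ^ 2 := by nlinarith
    have h4 : 0 ≤ L ^ 4 := by positivity
    calc L * L ^ 3 = L ^ 4 * 1 := by ring
      _ ≤ L ^ 4 * (L - 2) ^ 2 := mul_le_mul_of_nonneg_left h1 h4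
      _ = (L ^ 3 - 2 * L ^ 2) ^ 2 := by ring
  rw [le_div_iff₀ (by positivity)]
  exact (key _ hL3).trans (hsq.trans hsum)


end

end Summit.QuantumFields.YangMills.Theorems.CovarianceBound.Negative
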